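import Summits.FinalStateConjecture.FinalStateConjecture.Theses.LeakageWritesInInk

/-!
# Birth skeleton of `TemporalCascade` (stmt-FinalStateConjecture-18181) — layer-2 child of `LeakageTimeAnalyticity`, route LeakageWritesInInk

Three stubs: `stub_uniformPieceBound` — POINTWISE uniform bound on all derivatives of order `≤ k` of all temporal
pieces (classical; shared with `ProfileTailDecay`'s birth), used here only to certify `BddAbove` of the profile's index
sets, whence the tail profile is ANTITONE; `stub_pairSource` — THE PHYSICS, pointwise: beyond a threshold every
derivative of order `≤ k` of the piece at temporal frequency `λ'` is `≤ C λ'^N · prof k μ · prof k (λ' − μ)` for one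
`μ ∈ [λ'/16, λ'/2]` PLUS a slack `½ · prof k λ'` absorbing high×high→low beating and far tails (retarded response of
the linearised harmonic-gauge operator to the high×high paraproduct source with polynomial loss — TransferBound +
NoHeating of the card); `stub_envelope` — ABSTRACT real analysis (provable now, size M): for a nonnegative size
function, its `sSup` tail envelope `env` (antitone, bounded, rapidly decaying), the pointwise pair-source inequality
with slack implies the windowed cascade (window transfer `μ ↦ min μ (λ/2)` on `λ' ∈ [λ, 32λ]` at cost `32^N`; outputs
`λ' ≥ 32λ` are `≤ ¾ env λ` by rapid decay; a `sup` that is `≤ θ ·` itself vanishes). The composition PROVES the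
antitonicity of the canonical profile from stub 1 (`le_csSup` on nested index sets) and instantiates stub 3.

Shape (as in `Cruxes/BandFromNonradiation/Lines/birth.lean`): statement defs, sorried stubs `stub_*`, name-keyed aliases
`__Registered.stub_*` (abbrevs), the REAL composition `TemporalCascade_of : __Registered.stub_… → … → TemporalCascade` (conclusion = the
route decl by name), and a wiring `example`.
-/

set_option linter.dupNamespace false

namespace Summit.FinalStateConjecture.FinalStateConjecture.Cruxes.TemporalCascade.Birth

open scoped BigOperators Topology Manifold Classical MeasureTheory ProbabilityTheory Matrix InnerProductSpace ComplexConjugate ContinuousMap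
open Filter Set Function TopologicalSpace MeasureTheory
open Summit.FinalStateConjecture.FinalStateConjecture.Theses.LeakageWritesInInk

/-! ## Statements -/

/-- uniform pointwise bound on the derivatives of the pieces (classical; = the first stub of `ProfileTailDecay`'s birth). -/
def UniformPieceBound : Prop :=
  open Literature.Geometry.Lorentzian in ∀ (a r₀ : ℝ) (G : E4 → E4 →L[ℝ] E4 →L[ℝ] ℝ), (0 < r₀ ∧ MetricCoord.IsMetricOn G (Kerr.region a r₀ : Set E4) ∧ (∃ c₀ δ : ℝ, 0 < c₀ ∧ 0 < δ ∧ ∀ x ∈ Kerr.region a r₀, (E4.dx 0) (MetricCoord.sharpAt G x (E4.dx 0)) ≤ -c₀ ∧ (Kerr.radius a x < r₀ + δ → (fderiv ℝ (Kerr.radius a) x) (MetricCoord.sharpAt G x (fderiv ℝ (Kerr.radius a) x)) ≤ -c₀ ∧ c₀ ≤ (E4.dx 0) (MetricCoord.sharpAt G x (fderiv ℝ (Kerr.radius a) x)))) ∧ (∀ x ∈ Kerr.region a r₀, MetricCoord.ricAt G x = 0) ∧ (∀ x ∈ Kerr.region a r₀, ∑ β : Fin 4, MetricCoord.chrAt G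 x (MetricCoord.sharpAt G x (E4.dx β)) (E4.basisVector β) = 0) ∧ (∀ k : ℕ, ∃ C : ℝ, ∀ x ∈ Kerr.region a r₀, ‖iteratedFDeriv ℝ k G x‖ ≤ C ∧ ‖MetricCoord.sharpAt G x‖ ≤ C) ∧ (∃ C : ℝ, ∀ x ∈ Kerr.region a r₀, ‖G x - Minkowski.bilin‖ ≤ C / E4.spatialNorm x ∧ ‖iteratedFDeriv ℝ 1 G x‖ ≤ C / E4.spatialNorm x ^ 2 ∧ ‖iteratedFDeriv ℝ 2 G x‖ ≤ C / E4.spatialNorm x ^ 3)) → ∀ k : ℕ, ∃ M : ℝ, 0 < M ∧ ∀ (ν : ℝ) (m : ℕ), m ≤ k → ∀ x ∈ Kerr.region a r₀, ‖iteratedFDeriv ℝ m (fun y : E4 => ∫ τ : ℝ, (ν * (∫ ξ : ℝ, Real.cos (2 * Real.pi * ξ * (ν * τ)) * (Real.smoothTransition (2 - ξ ^ 2) - Real.smoothTransition (2 - (2 * ξ) ^ 2)))) • G (y + τ • E4.basisVector 0)) x‖ ≤ M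

/-- THE PHYSICS (hardest): the pointwise PAIR-SOURCE inequality with slack `½ prof k λ'` for the canonical tail profile. -/
def PairSource : Prop :=
  open Literature.Geometry.Lorentzian in ∀ (a r₀ : ℝ) (G : E4 → E4 →L[ℝ] E4 →L[ℝ] ℝ), (0 < r₀ ∧ MetricCoord.IsMetricOn G (Kerr.region a r₀ : Set E4) ∧ (∃ c₀ δ : ℝ, 0 < c₀ ∧ 0 < δ ∧ ∀ x ∈ Kerr.region a r₀, (E4.dx 0) (MetricCoord.sharpAt G x (E4.dx 0)) ≤ -c₀ ∧ (Kerr.radius a x < r₀ + δ → (fderiv ℝ (Kerr.radius a) x) (MetricCoord.sharpAt G x (fderiv ℝ (Kerr.radius a) x)) ≤ -c₀ ∧ c₀ ≤ (E4.dx 0) (MetricCoord.sharpAt G x (fderiv ℝ (Kerr.radius a) x)))) ∧ (∀ x ∈ Kerr.region a r₀, MetricCoord.ricAt G x = 0) ∧ (∀ x ∈ Kerr.region a r₀, ∑ β : Fin 4, MetricCoord.chrAt G x (MetricCoord.sharpAt G x (E4.dx β)) (E4.basisVector β) = 0) ∧ (∀ k : ℕ, ∃ C : ℝ, ∀ x ∈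 Kerr.region a r₀, ‖iteratedFDeriv ℝ k G x‖ ≤ C ∧ ‖MetricCoord.sharpAt G x‖ ≤ C) ∧ (∃ C : ℝ, ∀ x ∈ Kerr.region a r₀, ‖G x - Minkowski.bilin‖ ≤ C / E4.spatialNorm x ∧ ‖iteratedFDeriv ℝ 1 G x‖ ≤ C / E4.spatialNorm x ^ 2 ∧ ‖iteratedFDeriv ℝ 2 G x‖ ≤ C / E4.spatialNorm x ^ 3)) → ∀ prof : ℕ → ℝ → ℝ, prof = (fun (k : ℕ) (lam : ℝ) => sSup {q : ℝ | ∃ ν : ℝ, lam ≤ ν ∧ ∃ m : ℕ, m ≤ k ∧ ∃ x ∈ Kerr.region a r₀, q = ‖iteratedFDeriv ℝ m (fun y : E4 => ∫ τ : ℝ, (ν * (∫ ξ : ℝ, Real.cos (2 * Real.pi * ξ * (ν * τ)) * (Real.smoothTransition (2 - ξ ^ 2) - Real.smoothTransition (2 - (2 * ξ) ^ 2)))) • G (y + τ • E4.basisVector 0)) x‖}) → (∀ k : ℕ, (∃ M : ℝ, 0 < M ∧ ∀ lam : ℝ, 0 ≤ prof k lam ∧ prof k lam ≤ M) ∧ ∀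 K : ℕ, ∃ C' : ℝ, ∀ lam : ℝ, 1 ≤ lam → prof k lam ≤ C' / lam ^ K) → ∃ (k N : ℕ) (C lam₁ : ℝ), 0 < C ∧ ∀ lam' : ℝ, lam₁ ≤ lam' → ∃ μ ∈ Set.Icc (lam' / 16) (lam' / 2), ∀ m : ℕ, m ≤ k → ∀ x ∈ Kerr.region a r₀, ‖iteratedFDeriv ℝ m (fun y : E4 => ∫ τ : ℝ, (lam' * (∫ ξ : ℝ, Real.cos (2 * Real.pi * ξ * (lam' * τ)) * (Real.smoothTransition (2 - ξ ^ 2) - Real.smoothTransition (2 - (2 * ξ) ^ 2)))) • G (y + τ • E4.basisVector 0)) x‖ ≤ C * lam' ^ N * (prof k μ * prof k (lam' - μ)) + (1 / 2) * prof k lam'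

/-- abstract real analysis (provable now): tail-envelope bookkeeping — pair-source with slack ⇒ windowed cascade. -/
def EnvelopeLemma : Prop :=
  ∀ (U : Set Literature.Geometry.Lorentzian.E4) (k N : ℕ) (size : ℝ → ℕ → Literature.Geometry.Lorentzian.E4 → ℝ) (env : ℝ → ℝ) (C lam₁ : ℝ), 0 < C → (∀ ν m x, 0 ≤ size ν m x) → (∀ lam : ℝ, env lam = sSup {q : ℝ | ∃ ν : ℝ, lam ≤ ν ∧ ∃ m : ℕ, m ≤ k ∧ ∃ x ∈ U, q = size ν m x}) → Antitone env → (∃ M : ℝ, 0 < M ∧ ∀ lam : ℝ, 0 ≤ env lam ∧ env lam ≤ M) → (∀ K : ℕ, ∃ C' : ℝ, ∀ lam : ℝ, 1 ≤ lam → env lam ≤ C' / lam ^ K) → (∀ lam' : ℝ, lam₁ ≤ lam' → ∃ μ ∈ Set.Icc (lam' / 16) (lam' / 2), ∀ m : ℕ, m ≤ k → ∀ x ∈ U, size lam' m x ≤ C * lam' ^ N * (env μ * env (lam' - μ)) + (1 / 2) * env lam') → ∃ (N' : ℕ) (C' lam₁' : ℝ), 0 < C' ∧ ∀ lam : ℝ,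 lam₁' ≤ lam → ∃ μ ∈ Set.Icc (lam / 16) (lam / 2), env lam ≤ C' * lam ^ N' * (env μ * env (lam - μ))

/-! ## Stubs (the only `sorry`s) -/

/-- stub `stub_uniformPieceBound` : `UniformPieceBound` (the only sorries of the file are the stubs). -/
theorem stub_uniformPieceBound : UniformPieceBound := by
  sorry

/-- stub `stub_pairSource` : `PairSource` (the only sorries of the file are the stubs). -/
theorem stub_pairSource : PairSource := by
  sorry

/-- stub `stub_envelope` : `EnvelopeLemma` (the only sorries of the file are the stubs). -/
theorem stub_envelope : EnvelopeLemma := by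
  sorry

namespace __Registered

/-- Alias of `UniformPieceBound` keyed by the registered stub name. -/
abbrev stub_uniformPieceBound : Prop := UniformPieceBound
/-- Alias of `PairSource` keyed by the registered stub name. -/
abbrev stub_pairSource : Prop := PairSource
/-- Alias of `EnvelopeLemma` keyed by the registered stub name. -/
abbrev stub_envelope : Prop := EnvelopeLemma

end __Registered

/-- **Composition** (real proof, no sorry). -/
theorem TemporalCascade_of :
    __Registered.stub_uniformPieceBound → __Registered.stub_pairSource → __Registered.stub_envelope →
      Summit.FinalStateConjecture.FinalStateConjecture.Theses.LeakageWritesInInk.TemporalCascade := by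
  intro hU hP hE a r₀ G hG prof hprof hdecay
  obtain ⟨k, N, C, lam₁, hC, hPk⟩ := hP a r₀ G hG prof hprof hdecay
  obtain ⟨M₀, hM₀, hbd⟩ := hU a r₀ G hG k
  -- the canonical size function and the defining equation of `prof k`
  set size : ℝ → ℕ → Literature.Geometry.Lorentzian.E4 → ℝ :=
    fun ν m x => ‖iteratedFDeriv ℝ m (fun y : Literature.Geometry.Lorentzian.E4 => ∫ τ : ℝ, (ν * (∫ ξ : ℝ, Real.cos (2 * Real.pi * ξ * (ν * τ)) * (Real.smoothTransition (2 - ξ ^ 2) - Real.smoothTransition (2 - (2 * ξ) ^ 2)))) • G (y + τ • Literature.Geometry.Lorentzian.E4.basisVector 0)) x‖ with hsize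
  have hsize_nonneg : ∀ ν m x, 0 ≤ size ν m x := fun ν m x => norm_nonneg _
  have henv : ∀ lam : ℝ, prof k lam = sSup {q : ℝ | ∃ ν : ℝ, lam ≤ ν ∧ ∃ m : ℕ, m ≤ k ∧
      ∃ x ∈ (Literature.Geometry.Lorentzian.Kerr.region a r₀ : Set Literature.Geometry.Lorentzian.E4),
        q = size ν m x} := by
    intro lam
    subst hprof
    rfl
  -- every index set is bounded above by `M₀` (stub 1), hence the tail profile is antitone
  have hbdd : ∀ lam : ℝ, BddAbove {q : ℝ | ∃ ν : ℝ, lam ≤ ν ∧ ∃ m : ℕ, m ≤ k ∧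
      ∃ x ∈ (Literature.Geometry.Lorentzian.Kerr.region a r₀ : Set Literature.Geometry.Lorentzian.E4),
        q = size ν m x} := by
    intro lam
    refine ⟨M₀, ?_⟩
    rintro q ⟨ν, hν, m, hm, x, hx, rfl⟩
    exact hbd ν m hm x hx
  have hanti : Antitone (prof k) := by
    intro lam lam' hle
    rw [henv lam, henv lam']
    apply Real.sSup_le
    · rintro q ⟨ν, hν, m, hm, x, hx, rfl⟩
      exact le_csSup (hbdd lam) ⟨ν, le_trans hle hν, m, hm, x, hx, rfl⟩
    · apply Real.sSup_nonneg
      rintro q ⟨ν, hν, m, hm, x, hx, rfl⟩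
      exact hsize_nonneg ν m x
  obtain ⟨N', C', lam₁', hC', hcasc⟩ :=
    hE _ k N size (prof k) C lam₁ hC hsize_nonneg henv hanti (hdecay k).1 (hdecay k).2 hPk
  exact ⟨k, N', C', lam₁', hC', hcasc⟩

/-- WIRING CHECK (an `example`: no pre-composed witness enters the environment). -/
example : Summit.FinalStateConjecture.FinalStateConjecture.Theses.LeakageWritesInInk.TemporalCascade :=
  TemporalCascade_of stub_uniformPieceBound stub_pairSource stub_envelope

end Summit.FinalStateConjecture.FinalStateConjecture.Cruxes.TemporalCascade.Birth
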